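import Summits.CriticalPhenomena.Ising3DConformalLimit.Theorems.ArmHyperscalingOneArmHyperscalingMirrorFaceDefs
import Literature.Probability.LatticeModels.PlusStateFKG
import Literature.Probability.LatticeModels.IsingConsistency
import HarnessLib

/-!
# The plus box is the big box with its six faces frozen
(route ArmHyperscaling, crux `OneArmHyperscaling`, item stmt-CriticalPhenomena-15591, line
`mirror-face-saturation`, registered stub `stub_boxMagMarkov : BoxMagMarkov`)

Statement (`stub_boxMagMarkov`, literally the line's `def BoxMagMarkov : Prop` of the definitions
module `Theorems/ArmHyperscalingOneArmHyperscalingMirrorFaceDefs.lean`): on `ℤ³` at `β_c(3)`, `h = 0`,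
for `K n + n + 1 ≤ L`,
`plusBoxMag K n = frozenMag n L (⋃_i face K n i)`, i.e.
`⟨σ_0⟩⁺_{Λ_{Kn}} = ⟨σ_{x_n}⟩⁺_{Λ_L ∖ ⋃_{i<6} face K n i}` with `x_n = evalSite n = n e₀`.

Proof (two tree facts and linear integer arithmetic on three coordinates).
1. `plusBoxMag K n = ⟨σ_0⟩⁺_{Λ_{Kn}}` (`isingCorr` of a singleton is the expectation of `spinAt`).
2. Translation covariance of the finite-volume plus expectations (Friedli–Velenik 2017, §3.1,
   eq. (3.8); tree `isingExpect_plus_shift`) along `v = x_n`: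
   `⟨σ_{x_n}⟩⁺_B = ⟨σ_0⟩⁺_{Λ_{Kn}}` for the translated box `B = x_n + Λ_{Kn}`, since
   `σ_{x_n} ∘ θ_v = σ_0`.
3. Domain Markov property / restriction to an edge-separated sub-volume (Friedli–Velenik 2017,
   Exercise 3.15; tree `isingExpect_fixed_eq_of_separated`, the `+` boundary condition being
   `BoundaryCondition.fixed 1`): `B ⊆ W := Λ_L ∖ ⋃_i face K n i` (`shiftBox_subset_sdiff`: the
   coordinates of `B` are `|y₀ - n|, |y₁|, |y₂| ≤ Kn`, inside `Λ_L` because `Kn + n + 1 ≤ L`, and off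
   every face, whose fixed coordinate sits at distance `Kn + 1` from the centre), no edge of `ℤ³`
   joins `B` to `W ∖ B` (`shiftBox_separated`: a neighbour of a site of `B` outside `B` differs from
   it by `±1` in exactly one coordinate, hence lies on one of the six faces, which are removed from
   `W`), and `σ_{x_n}` is measurable and `B`-local (`x_n ∈ B`). Hence `⟨σ_{x_n}⟩⁺_W = ⟨σ_{x_n}⟩⁺_B`.

References: S. Friedli, Y. Velenik, *Statistical Mechanics of Lattice Systems* (CUP 2017), §3.1
eq. (3.8) (translation covariance), §3.6.3 eq. (3.26) and Exercise 3.15 with its solution in App. C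
(spatial Markov property). No definitions are introduced.
-/

noncomputable section

namespace Summit.CriticalPhenomena.Ising3DConformalLimit.Cruxes.OneArmHyperscaling.MirrorFaceSaturation

open Literature.Probability.LatticeModels Finset

/-- The centre `x_n` of the translated box `B = x_n + Λ_{Kn}` belongs to it (`0 ∈ Λ_{Kn}`). -/
private theorem evalSite_mem_shiftBox (K n : ℕ) :
    evalSite n ∈ (box 3 (K * n)).map (Site.shift (evalSite n)).toEmbedding := by
  rw [mem_map_shift_iff', sub_self]
  exact zero_mem_box _ _

/-- Adjacency in `ℤ³` in coordinates: two neighbours differ by `±1` in exactly one of the three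
coordinates and agree in the other two. -/
private theorem zdGraph_three_adj_coord {x y : Site 3} (h : (zdGraph 3).Adj x y) :
    ((y 0 = x 0 + 1 ∧ y 1 = x 1 ∧ y 2 = x 2) ∨ (x 0 = y 0 + 1 ∧ x 1 = y 1 ∧ x 2 = y 2)) ∨
    ((y 0 = x 0 ∧ y 1 = x 1 + 1 ∧ y 2 = x 2) ∨ (x 0 = y 0 ∧ x 1 = y 1 + 1 ∧ x 2 = y 2)) ∨
    ((y 0 = x 0 ∧ y 1 = x 1 ∧ y 2 = x 2 + 1) ∨ (x 0 = y 0 ∧ x 1 = y 1 ∧ x 2 = y 2 + 1)) := by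
  rw [zdGraph_adj_iff] at h
  simp only [funext_iff, Fin.exists_fin_succ, Fin.forall_fin_succ, Pi.add_apply,
    Pi.single_apply] at h
  simpa using h

/-- The translated box `B = x_n + Λ_{Kn}` in coordinates: `|y₀ - n| ≤ Kn`, `|y₁| ≤ Kn`, `|y₂| ≤ Kn`. -/
private theorem mem_shiftBox_iff (K n : ℕ) (y : Site 3) :
    y ∈ (box 3 (K * n)).map (Site.shift (evalSite n)).toEmbedding ↔
      ((n : ℤ) ≤ y 0 + (K : ℤ) * (n : ℤ) ∧ y 0 ≤ (K : ℤ) * (n : ℤ) + (n : ℤ)) ∧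
      (0 ≤ y 1 + (K : ℤ) * (n : ℤ) ∧ y 1 ≤ (K : ℤ) * (n : ℤ)) ∧
      0 ≤ y 2 + (K : ℤ) * (n : ℤ) ∧ y 2 ≤ (K : ℤ) * (n : ℤ) := by
  rw [mem_map_shift_iff', mem_box]
  simp [Fin.forall_fin_succ, evalSite]

/-- The union of the six faces of `B` in coordinates: a site lies on `⋃_i face K n i` iff one of its
coordinates sits at distance `Kn + 1` from the centre `x_n` on the corresponding side and the other
two are within `Kn` of it. -/
private theorem mem_biUnion_face_iff (K n : ℕ) (y : Site 3) :
    y ∈ Finset.univ.biUnion (face K n) ↔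
      (y 0 = (n : ℤ) - (K : ℤ) * (n : ℤ) - 1 ∧ (-((K : ℤ) * (n : ℤ)) ≤ y 1 ∧ y 1 ≤ (K : ℤ) * (n : ℤ)) ∧
          -((K : ℤ) * (n : ℤ)) ≤ y 2 ∧ y 2 ≤ (K : ℤ) * (n : ℤ)) ∨
      (y 0 = (n : ℤ) + (K : ℤ) * (n : ℤ) + 1 ∧ (-((K : ℤ) * (n : ℤ)) ≤ y 1 ∧ y 1 ≤ (K : ℤ) * (n : ℤ)) ∧
          -((K : ℤ) * (n : ℤ)) ≤ y 2 ∧ y 2 ≤ (K : ℤ) * (n : ℤ)) ∨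
      (((n : ℤ) ≤ y 0 + (K : ℤ) * (n : ℤ) ∧ y 0 ≤ (n : ℤ) + (K : ℤ) * (n : ℤ)) ∧
          y 1 = -((K : ℤ) * (n : ℤ)) - 1 ∧ -((K : ℤ) * (n : ℤ)) ≤ y 2 ∧ y 2 ≤ (K : ℤ) * (n : ℤ)) ∨
      (((n : ℤ) ≤ y 0 + (K : ℤ) * (n : ℤ) ∧ y 0 ≤ (n : ℤ) + (K : ℤ) * (n : ℤ)) ∧
          y 1 = (K : ℤ) * (n : ℤ) + 1 ∧ -((K : ℤ) * (n : ℤ)) ≤ y 2 ∧ y 2 ≤ (K : ℤ) * (n : ℤ)) ∨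
      (((n : ℤ) ≤ y 0 + (K : ℤ) * (n : ℤ) ∧ y 0 ≤ (n : ℤ) + (K : ℤ) * (n : ℤ)) ∧
          (-((K : ℤ) * (n : ℤ)) ≤ y 1 ∧ y 1 ≤ (K : ℤ) * (n : ℤ)) ∧ y 2 = -((K : ℤ) * (n : ℤ)) - 1) ∨
      (((n : ℤ) ≤ y 0 + (K : ℤ) * (n : ℤ) ∧ y 0 ≤ (n : ℤ) + (K : ℤ) * (n : ℤ)) ∧
          (-((K : ℤ) * (n : ℤ)) ≤ y 1 ∧ y 1 ≤ (K : ℤ) * (n : ℤ)) ∧ y 2 = (K : ℤ) * (n : ℤ) + 1) := by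
  simp [Finset.mem_biUnion, Fin.exists_fin_succ, face, facePatch, Fintype.mem_piFinset,
    Fin.forall_fin_succ]

/-- `B = x_n + Λ_{Kn}` lies in the big box `Λ_L` with the six faces of `B` removed, for
`Kn + n + 1 ≤ L`. -/
private theorem shiftBox_subset_sdiff {K n L : ℕ} (hL : K * n + n + 1 ≤ L) :
    (box 3 (K * n)).map (Site.shift (evalSite n)).toEmbedding ⊆
      box 3 L \ Finset.univ.biUnion (face K n) := by
  intro y hy
  rw [mem_shiftBox_iff] at hy
  rw [Finset.mem_sdiff, mem_box, mem_biUnion_face_iff]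
  simp only [Fin.forall_fin_succ, Fin.succ_zero_eq_one, Fin.succ_one_eq_two, IsEmpty.forall_iff,
    and_true]
  omega

/-- **Edge separation**: no edge of `ℤ³` joins `B = x_n + Λ_{Kn}` to the rest of
`Λ_L ∖ ⋃_i face K n i` — a neighbour of a site of `B` outside `B` lies on one of the six faces
(corners and edges of the surrounding cube are not neighbours of `B`). -/
private theorem shiftBox_separated (K n L : ℕ) :
    ∀ x ∈ (box 3 (K * n)).map (Site.shift (evalSite n)).toEmbedding,
      ∀ y ∈ (box 3 L \ Finset.univ.biUnion (face K n)) \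
          (box 3 (K * n)).map (Site.shift (evalSite n)).toEmbedding,
        ¬ (zdGraph 3).Adj x y := by
  intro x hx y hy hadj
  simp only [Finset.mem_sdiff] at hy
  obtain ⟨⟨-, hyF⟩, hyB⟩ := hy
  apply hyF
  clear hyF
  rw [mem_shiftBox_iff] at hx hyB
  rw [mem_biUnion_face_iff]
  rcases zdGraph_three_adj_coord hadj with (h | h) | (h | h) | (h | h)
  · exact Or.inr (Or.inl (by omega))
  · exact Or.inl (by omega)
  · exact Or.inr (Or.inr (Or.inr (Or.inl (by omega))))
  · exact Or.inr (Or.inr (Or.inl (by omega)))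
  · exact Or.inr (Or.inr (Or.inr (Or.inr (Or.inr (by omega)))))
  · exact Or.inr (Or.inr (Or.inr (Or.inr (Or.inl (by omega)))))

/-- **(MKV) the plus box is the big box with its six faces frozen** (registered stub
`stub_boxMagMarkov` of line `mirror-face-saturation`): for `K n + n + 1 ≤ L`,
`plusBoxMag K n = ⟨σ_{x_n}⟩⁺_{Λ_L ∖ ⋃_i face K n i}` at `β_c(3)`, `h = 0` — translation covariance
(Friedli–Velenik 2017, §3.1 eq. (3.8); tree `isingExpect_plus_shift`) and the domain Markov property
(Friedli–Velenik 2017, Exercise 3.15; tree `isingExpect_fixed_eq_of_separated`). -/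
theorem stub_boxMagMarkov : MirrorFaceSaturation.BoxMagMarkov := by
  intro K n L hL
  -- (2) translation covariance: `⟨σ_{x_n}⟩⁺_{x_n + Λ_{Kn}} = ⟨σ_0⟩⁺_{Λ_{Kn}}`
  have h2 : isingExpect (zdGraph 3) ((box 3 (K * n)).map (Site.shift (evalSite n)).toEmbedding)
      (criticalBeta 3) 0 .plus (spinAt (evalSite n)) =
      isingExpect (zdGraph 3) (box 3 (K * n)) (criticalBeta 3) 0 .plus (spinAt 0) := by
    rw [isingExpect_plus_shift _ _ _ _ (measurable_spinAt _)]
    congr 1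
    funext σ
    simp [spinAt, configShift_apply]
  -- (3) domain Markov: `⟨σ_{x_n}⟩⁺_{Λ_L ∖ ⋃ faces} = ⟨σ_{x_n}⟩⁺_{x_n + Λ_{Kn}}`
  have h3 : isingExpect (zdGraph 3) (box 3 L \ Finset.univ.biUnion (face K n)) (criticalBeta 3) 0
      .plus (spinAt (evalSite n)) =
      isingExpect (zdGraph 3) ((box 3 (K * n)).map (Site.shift (evalSite n)).toEmbedding)
        (criticalBeta 3) 0 .plus (spinAt (evalSite n)) :=
    isingExpect_fixed_eq_of_separated (zdGraph 3) (shiftBox_subset_sdiff hL)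
      (shiftBox_separated K n L) 1 _ _ (measurable_spinAt _) fun σ σ' hσ => by
        simp only [spinAt, hσ _ (evalSite_mem_shiftBox K n)]
  -- (1) + assembly
  unfold plusBoxMag frozenMag isingCorr
  rw [spinProduct_singleton, h3, h2]

end Summit.CriticalPhenomena.Ising3DConformalLimit.Cruxes.OneArmHyperscaling.MirrorFaceSaturation

end
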